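import Summits.CriticalPhenomena.PercolationContinuityZ3.Theorems.PercNearOneGluingNoHeavyLowerTailCubicThreePointGluingCells
import Mathlib.Tactic.Ring
import Mathlib.Tactic.Linarith
import HarnessLib

/-!
# `NoHeavyLowerTail` (stmt-CriticalPhenomena-4575) — decoupling across a vertex separator, part 7:
# a two-terminal BLOB between `u` and `v` acts on every three-point law exactly like a single edge `uv` of weight `P(u ↔ v in the blob)`

Support file (prover prim-sahi-p2, SAHI cell P2 "restricted C₃ via percolation structure"; `--supports stmt-CriticalPhenomena-4575`).  No definitions,
no named facts, no sorries.  Setting of parts 1–2a (`…CubicThreePointGluing`, `…GluingCells`): two pieces on disjoint random edge sets, `(D₁, K₁)` = the BLOB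
(an arbitrary network) and `(D₂, K₂)` = the HOST, whose edges meet only in the two-vertex separator `{u, v}` (`hsep`); the terminals `a, b, c` touch blob
edges only if they are `u` or `v` (`ha hb hc`).

* graph level (`blob_reachable_iff_of_conn`, `blob_reachable_iff_of_not_conn`): for such `x, y`, `x ↔ y` in the glued graph iff `x ↔ y` in the host
  with the edge `uv` added — when `u ↔ v` inside the blob — resp. in the host alone — when not (part 1's `reachable_sup_decomp` with `T = {u,v}`);
* cells (`ind_blob_cell`, pointwise; **`PrW_blob_Q/U₁/U₂/U₃/T`**, summed): every three-point cell of the glued system equals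
  `(1 − π)·(cell of the host) + π·(cell of the host with uv forced)`, `π = PrW D₁ p (evT K₁ u v v) = P(u ↔ v in the blob)` — by `PrW_split` this is
  LITERALLY the cell of the host plus one fresh edge `uv` of weight `π` (`PrW_blob_eq_edge`).
CONSEQUENCE ("blob substitution"): every statement about the three-point law (q,u₁,u₂,u₃,t) — Gladkov's AG, the cubic rows AG⁺, `H_{q+t}`, the sharp
dichotomy `Hmax3`, SHK3⁺ = Sahi's `E₃ ≥ 0` on the pairwise separations — holds for a graph iff it holds after replacing any two-terminal sub-network
(attached at two vertices, no terminal inside) by a single edge carrying its connection probability.  So the open conjectures reduce to graphs without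
such sub-networks, and the censuses' classification by blob skeletons (ttrl2 sahi/README) loses nothing.  The pendant move of part 2c and the chord
move are the cases where the substituted edge is incident to a terminal.
[cite: Grimmett1999, §2.2 (product measure: independence of disjoint edge sets)]; [cite: GladkovZimin2024HK, §4 (one-coordinate decomposition)]
-/

noncomputable section

namespace Summit.CriticalPhenomena.PercolationContinuityZ3.Theorems

namespace TerminalGluing

open Finset SimpleGraph Literature.Probability.Percolation Literature.Probability.Percolation.DecisionTree CubicThreePointStep

variable {V : Type*}

/-! ### Graph level: a two-vertex separator whose far side contains no terminal -/

section Graph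

variable {G₁ G₂ : SimpleGraph V} {u v : V}

/-- A blob-connection from a vertex touching the blob only at `u, v` to a vertex of the same kind (or to `u`, `v`) is trivial or joins
`u` and `v`. [folklore] -/
theorem blob_side_cases {x y : V} (hx : ∀ z, G₁.Adj x z → (x = u ∨ x = v)) (hy' : y = u ∨ y = v ∨ ∀ z, G₁.Adj y z → (y = u ∨ y = v))
    (h : G₁.Reachable x y) : x = y ∨ ((x = u ∨ x = v) ∧ (y = u ∨ y = v) ∧ x ≠ y) := by
  by_cases hxy : x = y
  · exact Or.inl hxy
  · obtain ⟨z, hz⟩ := exists_adj_of_reachable_ne h hxy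
    have hxuv := hx z hz
    have hyuv : y = u ∨ y = v := by
      rcases hy' with hy | hy | hy
      · exact Or.inl hy
      · exact Or.inr hy
      · obtain ⟨z', hz'⟩ := exists_adj_of_reachable_ne h.symm (Ne.symm hxy)
        exact hy z' hz'
    exact Or.inr ⟨hxuv, hyuv, hxy⟩

/-- Two distinct members of `{u, v}` are joined as soon as `u ↔ v`. [folklore] -/
theorem pair_reachable_of_uv {H : SimpleGraph V} {x y : V} (hx : x = u ∨ x = v) (hy : y = u ∨ y = v) (hxy : x ≠ y)
    (huv : H.Reachable u v) : H.Reachable x y := by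
  rcases hx with rfl | rfl <;> rcases hy with rfl | rfl
  · exact absurd rfl hxy
  · exact huv
  · exact huv.symm
  · exact absurd rfl hxy

/-- Conversely, a connection between two distinct members of `{u, v}` is a connection `u ↔ v`. [folklore] -/
theorem uv_reachable_of_pair {H : SimpleGraph V} {x y : V} (hx : x = u ∨ x = v) (hy : y = u ∨ y = v) (hxy : x ≠ y)
    (h : H.Reachable x y) : H.Reachable u v := by
  rcases hx with rfl | rfl <;> rcases hy with rfl | rfl
  · exact absurd rfl hxy
  · exact h
  · exact h.symm
  · exact absurd rfl hxy

/-- Case `u ↔ v` available in `G₂ ⊔ uv`: a one-piece connection from a vertex touching the blob only at `u, v` lives in `G₂ ⊔ uv`. [folklore] -/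
theorem blob_side_of_conn (huv' : (G₂ ⊔ edge u v).Reachable u v) {s s' : V} (hs : ∀ z, G₁.Adj s z → (s = u ∨ s = v))
    (hs' : s' = u ∨ s' = v ∨ ∀ z, G₁.Adj s' z → (s' = u ∨ s' = v)) (h : G₁.Reachable s s' ∨ G₂.Reachable s s') :
    (G₂ ⊔ edge u v).Reachable s s' := by
  rcases h with h1 | h2
  · rcases blob_side_cases hs hs' h1 with rfl | ⟨hsuv, hs'uv, hne⟩
    · exact Reachable.refl _
    · exact pair_reachable_of_uv hsuv hs'uv hne huv'
  · exact h2.mono le_sup_left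

/-- Case `u ↮ v` in the blob: a one-piece connection from a vertex touching the blob only at `u, v` lives in `G₂`. [folklore] -/
theorem blob_side_of_not_conn (huv : ¬ G₁.Reachable u v) {s s' : V} (hs : ∀ z, G₁.Adj s z → (s = u ∨ s = v))
    (hs' : s' = u ∨ s' = v ∨ ∀ z, G₁.Adj s' z → (s' = u ∨ s' = v)) (h : G₁.Reachable s s' ∨ G₂.Reachable s s') :
    G₂.Reachable s s' := by
  rcases h with h1 | h2
  · rcases blob_side_cases hs hs' h1 with rfl | ⟨hsuv, hs'uv, hne⟩
    · exact Reachable.refl _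
    · exact absurd (uv_reachable_of_pair hsuv hs'uv hne h1) huv
  · exact h2

/-- A terminal chain through `{u, v}` lives in `G₂ ⊔ uv`. [folklore] -/
theorem blob_chain_of_conn (huv' : (G₂ ⊔ edge u v).Reachable u v) {z z' : V}
    (h : Relation.ReflTransGen
      (fun s s' => s ∈ {w | w = u ∨ w = v} ∧ s' ∈ {w | w = u ∨ w = v} ∧ (G₁.Reachable s s' ∨ G₂.Reachable s s')) z z') :
    (G₂ ⊔ edge u v).Reachable z z' := by
  induction h with
  | refl => exact Reachable.refl _
  | tail _ hstep ih =>
    exact ih.trans (blob_side_of_conn huv' (fun _ _ => hstep.1) (hstep.2.1.elim Or.inl fun h => Or.inr (Or.inl h)) hstep.2.2)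

/-- A terminal chain through `{u, v}` lives in `G₂` when `u ↮ v` in the blob. [folklore] -/
theorem blob_chain_of_not_conn (huv : ¬ G₁.Reachable u v) {z z' : V}
    (h : Relation.ReflTransGen
      (fun s s' => s ∈ {w | w = u ∨ w = v} ∧ s' ∈ {w | w = u ∨ w = v} ∧ (G₁.Reachable s s' ∨ G₂.Reachable s s')) z z') :
    G₂.Reachable z z' := by
  induction h with
  | refl => exact Reachable.refl _
  | tail _ hstep ih =>
    exact ih.trans (blob_side_of_not_conn huv (fun _ _ => hstep.1) (hstep.2.1.elim Or.inl fun h => Or.inr (Or.inl h)) hstep.2.2)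

variable (hT : ∀ w z z', G₁.Adj w z → G₂.Adj w z' → (w = u ∨ w = v))
include hT

/-- **Blob with `u ↔ v` inside it = the edge `uv`.**  If the pieces share only `u, v` and `u ↔ v` in the blob `G₁`, then for vertices `x, y`
touching the blob only at `u, v`: `x ↔ y` in `G₁ ⊔ G₂` iff `x ↔ y` in `G₂ ⊔ uv`. [folklore] -/
theorem blob_reachable_iff_of_conn (huv : G₁.Reachable u v) {x y : V} (hx : ∀ z, G₁.Adj x z → (x = u ∨ x = v))
    (hy : ∀ z, G₁.Adj y z → (y = u ∨ y = v)) : (G₁ ⊔ G₂).Reachable x y ↔ (G₂ ⊔ edge u v).Reachable x y := by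
  have huv' : (G₂ ⊔ edge u v).Reachable u v := by
    by_cases h : u = v
    · rw [h]
    · exact Adj.reachable ((sup_adj _ _ _ _).2 (Or.inr ((edge_adj _ _ _ _).2 ⟨Or.inl ⟨rfl, rfl⟩, h⟩)))
  constructor
  · intro h
    rcases reachable_sup_decomp (T := {w | w = u ∨ w = v}) hT h with hs | ⟨z, z', hz, hz', hxz, hzz', hz'y⟩
    · exact blob_side_of_conn huv' hx (Or.inr (Or.inr hy)) hs
    · have h1 : (G₂ ⊔ edge u v).Reachable x z := blob_side_of_conn huv' hx (hz.elim Or.inl fun h => Or.inr (Or.inl h)) hxz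
      have h2 : (G₂ ⊔ edge u v).Reachable z z' := blob_chain_of_conn huv' hzz'
      have h3 : (G₂ ⊔ edge u v).Reachable y z' :=
        blob_side_of_conn huv' hy (hz'.elim Or.inl fun h => Or.inr (Or.inl h)) (hz'y.imp Reachable.symm Reachable.symm)
      exact (h1.trans h2).trans h3.symm
  · intro h
    rcases Literature.Probability.LatticeModels.reachable_sup_edge_imp G₂ u v h with h2 | ⟨h2, h2'⟩ | ⟨h2, h2'⟩
    · exact h2.mono le_sup_right
    · exact ((h2.mono le_sup_right).trans (huv.mono le_sup_left)).trans (h2'.mono le_sup_right)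
    · exact ((h2.mono le_sup_right).trans (huv.symm.mono le_sup_left)).trans (h2'.mono le_sup_right)

/-- **Blob without `u ↔ v` = no edge.**  If the pieces share only `u, v` and `u ↮ v` in the blob, then for `x, y` touching the blob only at `u, v`:
`x ↔ y` in `G₁ ⊔ G₂` iff `x ↔ y` in `G₂`. [folklore] -/
theorem blob_reachable_iff_of_not_conn (huv : ¬ G₁.Reachable u v) {x y : V} (hx : ∀ z, G₁.Adj x z → (x = u ∨ x = v))
    (hy : ∀ z, G₁.Adj y z → (y = u ∨ y = v)) : (G₁ ⊔ G₂).Reachable x y ↔ G₂.Reachable x y := by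
  constructor
  · intro h
    rcases reachable_sup_decomp (T := {w | w = u ∨ w = v}) hT h with hs | ⟨z, z', hz, hz', hxz, hzz', hz'y⟩
    · exact blob_side_of_not_conn huv hx (Or.inr (Or.inr hy)) hs
    · have h1 : G₂.Reachable x z := blob_side_of_not_conn huv hx (hz.elim Or.inl fun h => Or.inr (Or.inl h)) hxz
      have h2 : G₂.Reachable z z' := blob_chain_of_not_conn huv hzz'
      have h3 : G₂.Reachable y z' :=
        blob_side_of_not_conn huv hy (hz'.elim Or.inl fun h => Or.inr (Or.inl h)) (hz'y.imp Reachable.symm Reachable.symm)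
      exact (h1.trans h2).trans h3.symm
  · exact fun h => h.mono le_sup_right

end Graph

/-! ### Cell level -/

section Cells

variable [DecidableEq V] {D₁ D₂ K₁ K₂ : Finset (Sym2 V)} {u v a b c : V}
  (hsep : ∀ w : V, ∀ e₁ ∈ D₁ ∪ K₁, ∀ e₂ ∈ D₂ ∪ K₂, w ∈ e₁ → w ∈ e₂ → (w = u ∨ w = v))
  {S₁ S₂ : Finset (Sym2 V)} (hS₁ : S₁ ⊆ D₁) (hS₂ : S₂ ⊆ D₂)
include hsep hS₁ hS₂

/-- The two piece graphs of a configuration share only `u, v`. [folklore] -/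
theorem blob_hT (w z z' : V) (h1 : (fromEdgeSet (↑(S₁ ∪ K₁) : Set (Sym2 V))).Adj w z)
    (h2 : (fromEdgeSet (↑(S₂ ∪ K₂) : Set (Sym2 V))).Adj w z') : w = u ∨ w = v := by
  obtain ⟨e₁, he₁, hw₁, _⟩ := adj_mem_edge hS₁ h1
  obtain ⟨e₂, he₂, hw₂, _⟩ := adj_mem_edge hS₂ h2
  exact hsep w e₁ he₁ e₂ he₂ hw₁ hw₂

omit hsep hS₂ in
/-- A terminal touching blob edges only at `u, v` has blob neighbours only if it is `u` or `v`. [folklore] -/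
theorem blob_terminal {x : V} (hx : ∀ e ∈ D₁ ∪ K₁, x ∈ e → (x = u ∨ x = v)) (z : V)
    (h : (fromEdgeSet (↑(S₁ ∪ K₁) : Set (Sym2 V))).Adj x z) : x = u ∨ x = v := by
  obtain ⟨e₁, he₁, hx₁, _⟩ := adj_mem_edge hS₁ h
  exact hx e₁ he₁ hx₁

/-- **Glued connection between terminals, `u ↔ v` in the blob**: it is the host's connection with `uv` forced. [folklore] -/
theorem blob_R_iff_of_conn (huv : R K₁ S₁ u v) {x y : V} (hx : ∀ e ∈ D₁ ∪ K₁, x ∈ e → (x = u ∨ x = v))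
    (hy : ∀ e ∈ D₁ ∪ K₁, y ∈ e → (y = u ∨ y = v)) :
    R (K₁ ∪ K₂) (S₁ ∪ S₂) x y ↔ R (insert s(u, v) K₂) S₂ x y := by
  rw [R_union_iff, blob_reachable_iff_of_conn (blob_hT hsep hS₁ hS₂) huv (blob_terminal hS₁ hx) (blob_terminal hS₁ hy)]
  unfold R
  rw [fromEdgeSet_insert_eq]

/-- **Glued connection between terminals, `u ↮ v` in the blob**: it is the host's connection. [folklore] -/
theorem blob_R_iff_of_not_conn (huv : ¬ R K₁ S₁ u v) {x y : V} (hx : ∀ e ∈ D₁ ∪ K₁, x ∈ e → (x = u ∨ x = v))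
    (hy : ∀ e ∈ D₁ ∪ K₁, y ∈ e → (y = u ∨ y = v)) :
    R (K₁ ∪ K₂) (S₁ ∪ S₂) x y ↔ R K₂ S₂ x y := by
  rw [R_union_iff, blob_reachable_iff_of_not_conn (blob_hT hsep hS₁ hS₂) huv (blob_terminal hS₁ hx) (blob_terminal hS₁ hy)]
  rfl

variable (ha : ∀ e ∈ D₁ ∪ K₁, a ∈ e → (a = u ∨ a = v)) (hb : ∀ e ∈ D₁ ∪ K₁, b ∈ e → (b = u ∨ b = v))
  (hc : ∀ e ∈ D₁ ∪ K₁, c ∈ e → (c = u ∨ c = v))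
include ha hb hc

/-- **Pointwise blob substitution for a cell.**  For any event `X K` of configurations defined through the three terminal connections
`R K · a b, R K · a c, R K · b c` (the five cells are such), the indicator on the glued configuration is
`1{u ↔ v in blob}·(X of the host with uv forced) + (1 − 1{u ↔ v in blob})·(X of the host)`. [folklore] -/
theorem ind_blob_cell (X : Finset (Sym2 V) → Set (Finset (Sym2 V)))
    (hXdef : ∃ P : Prop → Prop → Prop → Prop, ∀ K S, S ∈ X K ↔ P (R K S a b) (R K S a c) (R K S b c)) :
    ind (X (K₁ ∪ K₂)) (S₁ ∪ S₂) =
      ind (evT K₁ u v v) S₁ * ind (X (insert s(u, v) K₂)) S₂ + (1 - ind (evT K₁ u v v) S₁) * ind (X K₂) S₂ := by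
  obtain ⟨P, hP⟩ := hXdef
  by_cases huv : R K₁ S₁ u v
  · have eab := blob_R_iff_of_conn hsep hS₁ hS₂ huv ha hb
    have eac := blob_R_iff_of_conn hsep hS₁ hS₂ huv ha hc
    have ebc := blob_R_iff_of_conn hsep hS₁ hS₂ huv hb hc
    rw [ind_of_mem (show S₁ ∈ evT K₁ u v v from ⟨huv, huv⟩)]
    have key : (S₁ ∪ S₂ ∈ X (K₁ ∪ K₂)) ↔ (S₂ ∈ X (insert s(u, v) K₂)) := by rw [hP, hP, eab, eac, ebc]
    by_cases hm : S₂ ∈ X (insert s(u, v) K₂)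
    · rw [ind_of_mem hm, ind_of_mem (key.2 hm)]; ring
    · rw [ind_of_not_mem hm, ind_of_not_mem (fun h => hm (key.1 h))]; ring
  · have eab := blob_R_iff_of_not_conn hsep hS₁ hS₂ huv ha hb
    have eac := blob_R_iff_of_not_conn hsep hS₁ hS₂ huv ha hc
    have ebc := blob_R_iff_of_not_conn hsep hS₁ hS₂ huv hb hc
    rw [ind_of_not_mem (fun h : S₁ ∈ evT K₁ u v v => huv h.1)]
    have key : (S₁ ∪ S₂ ∈ X (K₁ ∪ K₂)) ↔ (S₂ ∈ X K₂) := by rw [hP, hP, eab, eac, ebc]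
    by_cases hm : S₂ ∈ X K₂
    · rw [ind_of_mem hm, ind_of_mem (key.2 hm)]; ring
    · rw [ind_of_not_mem hm, ind_of_not_mem (fun h => hm (key.1 h))]; ring

end Cells

/-! ### The masses: blob = edge of weight `π = P(u ↔ v in the blob)` -/

section Masses

variable [DecidableEq V] {D₁ D₂ K₁ K₂ : Finset (Sym2 V)} (p : Sym2 V → ℝ) {u v a b c : V} (hD : Disjoint D₁ D₂)
  (hsep : ∀ w : V, ∀ e₁ ∈ D₁ ∪ K₁, ∀ e₂ ∈ D₂ ∪ K₂, w ∈ e₁ → w ∈ e₂ → (w = u ∨ w = v))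
  (ha : ∀ e ∈ D₁ ∪ K₁, a ∈ e → (a = u ∨ a = v)) (hb : ∀ e ∈ D₁ ∪ K₁, b ∈ e → (b = u ∨ b = v))
  (hc : ∀ e ∈ D₁ ∪ K₁, c ∈ e → (c = u ∨ c = v))
include hD hsep ha hb hc

/-- Summing the pointwise substitution identity. [folklore] -/
theorem PrW_blob_cell (X : Finset (Sym2 V) → Set (Finset (Sym2 V)))
    (hXdef : ∃ P : Prop → Prop → Prop → Prop, ∀ K S, S ∈ X K ↔ P (R K S a b) (R K S a c) (R K S b c)) :
    PrW (D₁ ∪ D₂) p (X (K₁ ∪ K₂)) =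
      (1 - PrW D₁ p (evT K₁ u v v)) * PrW D₂ p (X K₂) + PrW D₁ p (evT K₁ u v v) * PrW D₂ p (X (insert s(u, v) K₂)) := by
  rw [PrW_eq_ED, ED_union D₁ D₂ hD, PrW_eq_ED, PrW_eq_ED, PrW_eq_ED]
  have h1 : ED D₁ p (fun s => ED D₂ p fun T => ind (X (K₁ ∪ K₂)) (s ∪ T)) =
      ED D₁ p (fun s => ED D₂ p (ind (X K₂)) +
        (ED D₂ p (ind (X (insert s(u, v) K₂))) - ED D₂ p (ind (X K₂))) * ind (evT K₁ u v v) s) := by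
    refine ED_congr_sub D₁ p fun S₁ hS₁ => ?_
    rw [ED_congr_sub D₂ p (fun S₂ hS₂ => ind_blob_cell hsep hS₁ hS₂ ha hb hc X hXdef)]
    rw [show (fun S₂ => ind (evT K₁ u v v) S₁ * ind (X (insert s(u, v) K₂)) S₂ + (1 - ind (evT K₁ u v v) S₁) * ind (X K₂) S₂) =
        fun S₂ => ind (evT K₁ u v v) S₁ * ind (X (insert s(u, v) K₂)) S₂ + (1 - ind (evT K₁ u v v) S₁) * ind (X K₂) S₂ from rfl,
      ED_add, ED_mul_left, ED_mul_left]
    ring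
  rw [h1, ED_add, ED_mul_left, ED_const']
  ring

/-- **Blob substitution, cell `a|b|c`.** [folklore] -/
theorem PrW_blob_Q : PrW (D₁ ∪ D₂) p (evQ (K₁ ∪ K₂) a b c) =
    (1 - PrW D₁ p (evT K₁ u v v)) * PrW D₂ p (evQ K₂ a b c) + PrW D₁ p (evT K₁ u v v) * PrW D₂ p (evQ (insert s(u, v) K₂) a b c) :=
  PrW_blob_cell p hD hsep ha hb hc (fun K => evQ K a b c) ⟨fun r₁ r₂ r₃ => ¬ r₁ ∧ ¬ r₂ ∧ ¬ r₃, fun _ _ => Iff.rfl⟩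

/-- **Blob substitution, cell `ab|c`.** [folklore] -/
theorem PrW_blob_U₁ : PrW (D₁ ∪ D₂) p (evU₁ (K₁ ∪ K₂) a b c) =
    (1 - PrW D₁ p (evT K₁ u v v)) * PrW D₂ p (evU₁ K₂ a b c) + PrW D₁ p (evT K₁ u v v) * PrW D₂ p (evU₁ (insert s(u, v) K₂) a b c) :=
  PrW_blob_cell p hD hsep ha hb hc (fun K => evU₁ K a b c) ⟨fun r₁ r₂ _ => r₁ ∧ ¬ r₂, fun _ _ => Iff.rfl⟩

/-- **Blob substitution, cell `ac|b`.** [folklore] -/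
theorem PrW_blob_U₂ : PrW (D₁ ∪ D₂) p (evU₂ (K₁ ∪ K₂) a b c) =
    (1 - PrW D₁ p (evT K₁ u v v)) * PrW D₂ p (evU₂ K₂ a b c) + PrW D₁ p (evT K₁ u v v) * PrW D₂ p (evU₂ (insert s(u, v) K₂) a b c) :=
  PrW_blob_cell p hD hsep ha hb hc (fun K => evU₂ K a b c) ⟨fun r₁ r₂ _ => r₂ ∧ ¬ r₁, fun _ _ => Iff.rfl⟩

/-- **Blob substitution, cell `bc|a`.** [folklore] -/
theorem PrW_blob_U₃ : PrW (D₁ ∪ D₂) p (evU₃ (K₁ ∪ K₂) a b c) =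
    (1 - PrW D₁ p (evT K₁ u v v)) * PrW D₂ p (evU₃ K₂ a b c) + PrW D₁ p (evT K₁ u v v) * PrW D₂ p (evU₃ (insert s(u, v) K₂) a b c) :=
  PrW_blob_cell p hD hsep ha hb hc (fun K => evU₃ K a b c) ⟨fun r₁ _ r₃ => r₃ ∧ ¬ r₁, fun _ _ => Iff.rfl⟩

/-- **Blob substitution, cell `abc`.** [folklore] -/
theorem PrW_blob_T : PrW (D₁ ∪ D₂) p (evT (K₁ ∪ K₂) a b c) =
    (1 - PrW D₁ p (evT K₁ u v v)) * PrW D₂ p (evT K₂ a b c) + PrW D₁ p (evT K₁ u v v) * PrW D₂ p (evT (insert s(u, v) K₂) a b c) :=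
  PrW_blob_cell p hD hsep ha hb hc (fun K => evT K a b c) ⟨fun r₁ r₂ _ => r₁ ∧ r₂, fun _ _ => Iff.rfl⟩

/-- **Blob = one edge of weight `π`.**  For a coordinate `e ∉ D₂` and a weight function `p'` agreeing with `p` on `D₂` and with
`p' e = π = PrW D₁ p (evT K₁ u v v)` — where we take `e = s(u,v)` — every cell of the glued system equals the cell of the host plus the
single random edge `e` (`PrW_split`). [folklore] -/
theorem PrW_blob_eq_edge (he : s(u, v) ∉ D₂) {p' : Sym2 V → ℝ} (hp' : ∀ e ∈ D₂, p' e = p e)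
    (hπ : p' s(u, v) = PrW D₁ p (evT K₁ u v v)) (X : Finset (Sym2 V) → Set (Finset (Sym2 V)))
    (hXdef : ∃ P : Prop → Prop → Prop → Prop, ∀ K S, S ∈ X K ↔ P (R K S a b) (R K S a c) (R K S b c)) :
    PrW (D₁ ∪ D₂) p (X (K₁ ∪ K₂)) = PrW (insert s(u, v) D₂) p' (X K₂) := by
  rw [PrW_blob_cell p hD hsep ha hb hc X hXdef, PrW_split D₂ p' he, hπ]
  have hsec : {S : Finset (Sym2 V) | insert s(u, v) S ∈ X K₂} = X (insert s(u, v) K₂) := by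
    obtain ⟨P, hP⟩ := hXdef
    ext S
    simp only [Set.mem_setOf_eq, hP, R_insert_config_iff]
  -- `PrW D₂ p' = PrW D₂ p` on any event: the weights agree on `D₂`
  have hw : ∀ Y : Set (Finset (Sym2 V)), PrW D₂ p' Y = PrW D₂ p Y := fun Y => by
    unfold PrW
    refine Finset.sum_congr rfl fun S hS => ?_
    have : wtW D₂ p' S = wtW D₂ p S := by
      unfold wtW
      exact Finset.prod_congr rfl fun i hi => by rw [hp' i hi]
    by_cases hY : S ∈ Y
    · rw [Set.indicator_of_mem hY, Set.indicator_of_mem hY, this]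
    · rw [Set.indicator_of_notMem hY, Set.indicator_of_notMem hY]
  rw [hsec, hw, hw]

end Masses

end TerminalGluing

end Summit.CriticalPhenomena.PercolationContinuityZ3.Theorems
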